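import Literature.NumberTheory.GaloisCohomology.Howard2004.ConjugationDatumTransportIndependenceProofs
import Literature.NumberTheory.GaloisCohomology.Howard2004.ResidualShaTwoVanishingProofs
import HarnessLib

/-!
# Howard 2004, H.4/H.5 at the bottom level of a full tower: the local Tate pairing against the conjugation transport
# is SYMMETRIC UNDER `v ↔ v̄` on (global, local) pairs — proofs file (brick «C451-CL Q6a FLIP0»)

Topic `NumberTheory/GaloisCohomology/Howard2004`. THEOREMS ONLY: no definition, no named fact, no instance, no notation,
no `sorry`.  Cell `pub/bsd-print-x9` (seat `bsd-line-x10b-p1` LEAD g14, `--supports stmt-BirchSwinnertonDyer-22642`).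

WHY.  In the class-level port of Howard's Prop. 1.4.1 (Flach's pairing read on classes, `Ш²(K, T̄) = 0`), the skew
identity «`(a, π^{s-1} b)_{s,1} = -(b, π^{s-1} a)_{s,1}`» (display (ii) of the proof of Thm. 1.4.2) is obtained from the
reciprocity law for the global pair `(ã, Ψ b̃)` at level `t+1`; after the cross-level adjointness every term lives at
level `0 = T̄`, and the ONE genuinely local input is the symmetry of the level-`0` pairing
`⟨x, y⟩_v := inv_v(x ∪ Θ₀ transport_v y)`, `x ∈ H¹(K_v, T̄)`, `y ∈ H¹(K_v̄, T̄)` (H.4's `T × Tw T → R(1)` read through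
`Θ₀ : Tw(T̄) ⥲ T̄^D`), under the swap `v ↔ v̄`, needed only when ONE of the two classes is the localisation of a
GLOBAL class: **`⟨loc_v c, y⟩_v = ⟨y, loc_v̄ (τ_* c)⟩_v̄`**, `τ_*` the action of complex conjugation on `H¹(K, T̄)`
(`loc_v̄ (τ_* c) = Θ₀ transport_v̄ (loc_v c)`).  This is Howard's «`G_ℚ`-invariant local Tate pairing» (Lemma 1.5.3)
— in the tree `DualityDatum.inv_cohomologyMap_cupProduct_thetaH1_transportH1` (hGQ, every conjugation datum) — combined
with the symmetry of `∪_P`, `P(s,t) = ē(s, θ t)` (`cupProduct_thetaPairing_comm`), the compatibility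
`τ_v ∘ loc_v̄ = loc_v ∘ τ_*` (`ResidualTau.localization_semilinearH`) and `τ_* ∘ τ_* = id` (`semilinearH_semilinearH`);
no local «`τ_v ∘ τ_v̄ = id`» is needed.

WHAT IS PROVED, for a `DVRSetting` `S` with H.0–H.5 and `e₀ = 1` (the bottom of a FULL tower, `T^{(0)} = T̄`):
* §1 `maximalIdeal_levelRing_zero_eq_bot` (`R₀ = R/𝔪` is a field), **`exists_residualTau_levelZero`** — H.5(a)'s `θ`
  transported to `T^{(0)}` along H.1's `π̄₀ : T^{(0)} ⥲ T̄` (`πbar_zero_bijective`): an `R₀`-linear involution `θ₀` with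
  `θ₀ ∘ ρ(g^τ) = ρ(g) ∘ θ₀`, `π̄₀ ∘ θ₀ = θ ∘ π̄₀`, AND the H.5(c) sign **`e₀(θ₀ s, θ₀ t) = -e₀(s, t)`** (from `SatisfiesH.h5c 0`,
  exact because `𝔪_{R₀} = 0`);
* §2 **`DVRSetting.localTatePairingZMod_localization_transportH1_flip`** — for `Θ₀ := (S.D 0).toTateDual λ hλ exp hexp`,
  a `σ`-compatible family `inv` (`IsConjCompatible`), a GLOBAL `c ∈ H¹(K, T^{(0)})`, a finite place `v` and a LOCAL
  `y ∈ H¹(K_{σv}, T^{(0)})`: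
  `⟨loc_v c, H¹(Θ₀)(transport_v y)⟩_v = ⟨y, H¹(Θ₀)(transport_{σv}(loc_{σσv} c))⟩_{σv}`
  (`⟨·,·⟩_w = localTatePairingZMod (S.T.ρ 0) (p^k) (inr w) (inv (inr w))`), together with the `θ₀`-form
  `localTatePairingZMod_eq_inv_cupProduct_thetaH1` used on the way (bridge `cohomologyMap_localCup_eq_localTatePairing` +
  `localCup_eq_cupProduct_thetaH1`).

HONEST FRAMING: Prop. 1.4.1, Thm. 1.4.2, C45.1′/C45.1″ and `thm161_dvrKolyvaginBound` are NOT proved here; no summit statement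
is proved; the Birch–Swinnerton-Dyer conjecture is not proved by any of this.

References: [Howard2004HeegnerKolyvagin] B. Howard, Compositio Math. **140** (2004) = arXiv:1202.6340, §1.3 H.4/H.5 and Rem. 1.3.2
(p. 7 L69 – p. 8 L22), Lemma 1.5.3 (p. 10 L10–16), Thm. 1.4.2 (ii) (p0008 L142 – p0009 L55: «flippity»); [CasselsFrohlichANT1967]
Ch. VI §1.1; [NeukirchSchmidtWingberg2008] I §4 (1.4.4); [MorganSmith2021CTP] Thm. 3.7 and §6.3.1.
-/

set_option autoImplicit false

noncomputable section

namespace Literature.NumberTheory.GaloisCohomology.Howard2004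

open Function NumberField IsDedekindDomain Field CategoryTheory
open scoped NumberField ContRepresentation
open Literature.NumberTheory.GaloisRepresentations
open Literature.NumberTheory.GaloisRepresentations.DiscreteGaloisModule
open Literature.NumberTheory.EllipticCurves

namespace DVRSetting

variable {p : ℕ} [Fact p.Prime] {K : Type} [Field K] [NumberField K]
  {R : Type} [CommRing R] [IsDomain R] [IsDiscreteValuationRing R] [Algebra ℤ_[p] R]
  {N : ℕ → Type} [∀ k, AddCommGroup (N k)] [∀ k, TopologicalSpace (N k)]
  [∀ k, DiscreteTopology (N k)] [∀ k, Module R (N k)]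
  {Rk : ℕ → Type} [∀ k, CommRing (Rk k)] [∀ k, IsLocalRing (Rk k)] [∀ k, TopologicalSpace (Rk k)]
  [∀ k, DiscreteTopology (Rk k)] [∀ k, Algebra ℤ_[p] (Rk k)] [∀ k, Algebra R (Rk k)]
  [∀ k, Module (Rk k) (N k)] [∀ k, IsScalarTower R (Rk k) (N k)]
  {Nbar : Type} [AddCommGroup Nbar] [TopologicalSpace Nbar] [DiscreteTopology Nbar]
  [∀ k, Module (Rk k) Nbar]
  {Nq : ℕ → Finset (HeightOneSpectrum (𝓞 K)) → Type} [∀ k n, AddCommGroup (Nq k n)]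
  [∀ k n, TopologicalSpace (Nq k n)] [∀ k n, DiscreteTopology (Nq k n)]
  [∀ k n, Module (Rk k) (Nq k n)] [∀ k n, Module R (Nq k n)]
  [∀ k n, IsScalarTower R (Rk k) (Nq k n)]

/-! ## §1 H.5(a)/(c) transported to the bottom level `T^{(0)} = T̄` of a full tower -/

/-- **`𝔪_{R₀} = 0` when `e₀ = 1`**: `R₀ = R/𝔪^{e₀} = R/𝔪` is the residue field (every element of `𝔪_{R₀}` lifts to a
non-unit of `R`, i.e. to `𝔪 = ker(R → R₀)`). [cite: Howard2004HeegnerKolyvagin, §1.6 (arXiv:1202.6340 p. 11 L33–34: `R^{(k)} = R/𝔪^k`)] -/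
theorem maximalIdeal_levelRing_zero_eq_bot (S : DVRSetting p K R N Rk Nbar Nq) (hy : S.SatisfiesH)
    (he : S.e 0 = 1) : IsLocalRing.maximalIdeal (Rk 0) = ⊥ := by
  rw [eq_bot_iff]
  intro r hr
  rw [Ideal.mem_bot]
  obtain ⟨r', rfl⟩ := hy.algebraMap_surjective 0 r
  have hr' : r' ∈ IsLocalRing.maximalIdeal R := by
    by_contra hne
    have hu : IsUnit r' := by
      by_contra hnu
      exact hne ((IsLocalRing.mem_maximalIdeal r').2 hnu)
    exact ((IsLocalRing.mem_maximalIdeal _).1 hr) (hu.map (algebraMap R (Rk 0)))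
  have hker : r' ∈ RingHom.ker (algebraMap R (Rk 0)) := by
    rw [hy.ker_algebraMap 0, he, pow_one]
    exact hr'
  exact (RingHom.mem_ker).1 hker

/-- **H.5(a) and H.5(c) on `T^{(0)}` (`e₀ = 1`)**: the involution `θ` of `T̄` transported along H.1's bijection
`π̄₀ : T^{(0)} ⥲ T̄` is an `R₀`-linear involution `θ₀` of `T^{(0)}` intertwining `Tw(T^{(0)})` and `T^{(0)}`
(a `ResidualTau` for `S.T.ρ 0`) with `π̄₀ ∘ θ₀ = θ ∘ π̄₀`, and H.5(c) «`(s^τ, t^τ) = (s,t)^τ`, `χ(τ) = -1`» holds EXACTLY for the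
level-`0` pairing: `e₀(θ₀ s, θ₀ t) = -e₀(s, t)` (H.5(c) is stated modulo `𝔪_{R₀}`, which is `0`).
[cite: Howard2004HeegnerKolyvagin, §1.3 H.1, H.5(a), H.5(c) (arXiv:1202.6340 p. 7 L59, L93–95, L98 – p. 8 L1)] -/
theorem exists_residualTau_levelZero (S : DVRSetting p K R N Rk Nbar Nq) (hy : S.SatisfiesH) (he : S.e 0 = 1) :
    ∃ A₀ : ResidualTau (R := Rk 0) S.cd (S.T.ρ 0),
      (∀ s : N 0, S.πbar 0 (A₀.θ s) = (S.A 0).θ (S.πbar 0 s)) ∧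
      ∀ s t : N 0, (S.D 0).e (A₀.θ s) (A₀.θ t) = -(S.D 0).e s t := by
  have hbij := S.πbar_zero_bijective hy he
  let e : N 0 ≃ₗ[Rk 0] Nbar := LinearEquiv.ofBijective (S.πbar 0) hbij
  have he_apply : ∀ s, e s = S.πbar 0 s := fun _ ↦ rfl
  let θ₀ : N 0 →ₗ[Rk 0] N 0 := e.symm.toLinearMap ∘ₗ (S.A 0).θ ∘ₗ e.toLinearMap
  have hθ₀ : ∀ s, θ₀ s = e.symm ((S.A 0).θ (S.πbar 0 s)) := fun _ ↦ rfl
  have hπθ₀ : ∀ s, S.πbar 0 (θ₀ s) = (S.A 0).θ (S.πbar 0 s) := fun s ↦ by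
    rw [hθ₀, ← he_apply, e.apply_symm_apply]
  refine ⟨⟨θ₀, fun s ↦ hbij.1 ?_, fun g s ↦ hbij.1 ?_⟩, hπθ₀, fun s t ↦ ?_⟩
  · rw [hπθ₀, hπθ₀, (S.A 0).involutive]
  · rw [hπθ₀, (hy.h1 0).1.equivariant, (hy.h1 0).1.equivariant, (S.A 0).compat, hπθ₀]
  · -- H.5(c) at level 0, exact since `𝔪_{R₀} = ⊥`
    have h5 := hy.h5c 0 s t (θ₀ s) (θ₀ t) (hπθ₀ s) (hπθ₀ t)
    rw [← map_neg] at h5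
    have hinj : Function.Injective (Ideal.Quotient.mk (IsLocalRing.maximalIdeal (Rk 0))) := by
      rw [RingHom.injective_iff_ker_eq_bot, Ideal.mk_ker]
      exact S.maximalIdeal_levelRing_zero_eq_bot hy he
    exact hinj h5

/-! ## §2 The flip `v ↔ σv` for (global, local) pairs at level `0` -/

section Flip

variable (S : DVRSetting p K R N Rk Nbar Nq) (hy : S.SatisfiesH) {k : ℕ}
  (lam : Rk 0 →+ ZMod (p ^ k))
  (hlam : ∀ (z : ℤ_[p]) (r : Rk 0), lam (algebraMap ℤ_[p] (Rk 0) z * r) = PadicInt.toZModPow k z * lam r)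
  (exp : ZMod (p ^ k) →+ MuCarrier K (p ^ k))
  (hexp : ∀ (g : absoluteGaloisGroup K) (x : ZMod (p ^ k)),
    exp (cyclotomicCharacterModPow K p k g * x) = mu K (p ^ k) g (exp x))

/-- **The level-`0` local Tate pairing in `θ₀`-form**: for `x ∈ H¹(K_w, T^{(0)})`, `z ∈ H¹(K_w, Tw T^{(0)})` and any
`ResidualTau` `A₀` on `T^{(0)}`,
`⟨x, H¹(Θ₀) z⟩_w = inv_w (H²(exp λ)(x ∪_P θ₀_* z))`, `P(s,t) = e₀(s, θ₀ t)` — the bridge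
`cohomologyMap_localCup_eq_localTatePairing` (read backwards) followed by `localCup_eq_cupProduct_thetaH1`.
[cite: Howard2004HeegnerKolyvagin, §1.3 H.4 and Rem. 1.3.2 (arXiv:1202.6340 p. 7 L78–82, p. 8 L13–22)] [cite: NeukirchSchmidtWingberg2008, I §4 (1.4.2)] -/
theorem localTatePairingZMod_eq_inv_cupProduct_thetaH1 [Finite (N 0)] (A₀ : ResidualTau (R := Rk 0) S.cd (S.T.ρ 0))
    (inv : LocalInvariants K (p ^ k)) (w : Place K)
    (x : galoisCohomology ((S.T.ρ 0).toLocal w) 1) (z : galoisCohomology ((S.cd.twist (S.T.ρ 0)).toLocal w) 1) :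
    localTatePairingZMod (S.T.ρ 0) (p ^ k) w (inv w) x
        (galoisCohomology.map (DiscreteGaloisModule.localMap ((S.D 0).toTateDual lam hlam exp hexp) w) 1 z) =
      inv w (cohomologyMap ((S.D 0).expLamLocalHom lam hlam exp hexp w) 2
        (haveI : CompactSpace (absoluteGaloisGroup (Place.Completion w)) := absoluteGaloisGroup_compactSpace _;
          (DiscreteGaloisModule.pairing ((S.T.ρ 0).toLocal w) ((S.T.ρ 0).toLocal w) ((S.D 0).twistOne.toLocal w)
              ((S.D 0).eHom.compl₂ A₀.θ.toAddMonoidHom) ((S.D 0).thetaPairing_equivariant_toLocal A₀ w)).cupProduct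
            x (A₀.thetaH1 w z))) := by
  rw [localTatePairingZMod_apply, ← (S.D 0).cohomologyMap_localCup_eq_localTatePairing lam hlam exp hexp w x z,
    (S.D 0).localCup_eq_cupProduct_thetaH1 A₀ w x z]

include hy hlam hexp in
/-- **FLIP `v ↔ σv` for (global, local) pairs at the bottom level of a full tower.**  On a `DVRSetting` with H.0–H.5 and
`e₀ = 1`, with `Θ₀ := (S.D 0).toTateDual λ hλ exp hexp : Tw(T^{(0)}) → (T^{(0)})^D` and a `σ`-compatible family of local
invariant maps: for a GLOBAL class `c ∈ H¹(K, T^{(0)})`, a finite place `v` and a LOCAL class `y ∈ H¹(K_{σv}, T^{(0)})`,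
`⟨loc_v c, H¹(Θ₀)(transport_v y)⟩_v = ⟨y, H¹(Θ₀)(transport_{σv}(loc_{σσv} c))⟩_{σv}`.
Proof: with `θ₀` of §1 and `τ_* :=` the global action (`semilinearH`), `loc_v c = τ_v (loc_{σv} (τ_* c))`
(`localization_semilinearH`, `semilinearH_semilinearH`), so the left side is `inv_v(τ_v x ∪_P τ_v y)` with
`x = loc_{σv}(τ_* c)`; Howard's `G_ℚ`-invariance `= inv_{σv}(x ∪_P y)` (`inv_cohomologyMap_cupProduct_thetaH1_transportH1`,
H.5(c) letter from §1) and the symmetry of `∪_P` (`cupProduct_thetaPairing_comm`) give `inv_{σv}(y ∪_P x)`, which is the right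
side by `localization_semilinearH` at `σv`.
[cite: Howard2004HeegnerKolyvagin, Lemma 1.5.3 («the `G_ℚ`-invariant local Tate pairing») and Thm. 1.4.2 (ii) (arXiv:1202.6340 p. 10 L10–16; p0008 L142 – p0009 L55)]
[cite: CasselsFrohlichANT1967, Ch. VI §1.1] [cite: MorganSmith2021CTP, Thm. 3.7 and §6.3.1] -/
theorem localTatePairingZMod_localization_transportH1_flip [Finite (N 0)] (he : S.e 0 = 1)
    (inv : LocalInvariants K (p ^ k)) (hinv : inv.IsConjCompatible S.cd.σ)
    (c : galoisCohomology (S.T.ρ 0) 1) (v : HeightOneSpectrum (𝓞 K))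
    (y : galoisCohomology ((S.T.ρ 0).toLocal (Sum.inr (S.cd.σ • v))) 1) :
    localTatePairingZMod (S.T.ρ 0) (p ^ k) (Sum.inr v) (inv (Sum.inr v))
        (galoisCohomology.localization (S.T.ρ 0) (Sum.inr v) 1 c)
        (galoisCohomology.map (DiscreteGaloisModule.localMap ((S.D 0).toTateDual lam hlam exp hexp) (Sum.inr v)) 1
          (S.cd.transportH1 (S.T.ρ 0) v y)) =
      localTatePairingZMod (S.T.ρ 0) (p ^ k) (Sum.inr (S.cd.σ • v)) (inv (Sum.inr (S.cd.σ • v))) y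
        (galoisCohomology.map (DiscreteGaloisModule.localMap ((S.D 0).toTateDual lam hlam exp hexp)
            (Sum.inr (S.cd.σ • v))) 1
          (S.cd.transportH1 (S.T.ρ 0) (S.cd.σ • v)
            (galoisCohomology.localization (S.T.ρ 0) (Sum.inr (S.cd.σ • (S.cd.σ • v))) 1 c))) := by
  obtain ⟨A₀, -, hθ₀⟩ := S.exists_residualTau_levelZero hy he
  have hv : S.cd.σ • (S.cd.σ • v) = v := by
    rw [smul_smul, S.cd.sigma_mul_sigma_eq_one, one_smul]
  -- the global action of `τ` on `H¹(K, T^{(0)})` and its localisations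
  set τc := semilinearH S.cd.isLift A₀.θ.toAddMonoidHom A₀.isSemilinear 1 c with hτc
  have hcc : semilinearH S.cd.isLift A₀.θ.toAddMonoidHom A₀.isSemilinear 1 τc = c :=
    A₀.semilinearH_semilinearH c
  -- `loc_v c = τ_v (loc_{σv} τc)`
  have hlocv : galoisCohomology.localization (S.T.ρ 0) (Sum.inr v) 1 c =
      A₀.thetaH1 (Sum.inr v) (S.cd.transportH1 (S.T.ρ 0) v
        (galoisCohomology.localization (S.T.ρ 0) (Sum.inr (S.cd.σ • v)) 1 τc)) := by
    rw [← A₀.localization_semilinearH v τc, hcc]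
  -- `loc_{σv} τc = τ_{σv} (loc_{σσv} c)`
  have hlocσ : galoisCohomology.localization (S.T.ρ 0) (Sum.inr (S.cd.σ • v)) 1 τc =
      A₀.thetaH1 (Sum.inr (S.cd.σ • v)) (S.cd.transportH1 (S.T.ρ 0) (S.cd.σ • v)
        (galoisCohomology.localization (S.T.ρ 0) (Sum.inr (S.cd.σ • (S.cd.σ • v))) 1 c)) :=
    A₀.localization_semilinearH (S.cd.σ • v) c
  rw [S.localTatePairingZMod_eq_inv_cupProduct_thetaH1 lam hlam exp hexp A₀ inv (Sum.inr v),
    S.localTatePairingZMod_eq_inv_cupProduct_thetaH1 lam hlam exp hexp A₀ inv (Sum.inr (S.cd.σ • v)),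
    hlocv, (S.D 0).inv_cohomologyMap_cupProduct_thetaH1_transportH1 A₀ lam hlam exp hexp hθ₀ inv hinv v hv,
    (S.D 0).cupProduct_thetaPairing_comm A₀ (Sum.inr (S.cd.σ • v)) hθ₀, hlocσ]

end Flip

/-! ## §3 The flip of a (global, local) SUM over a `σ`-stable set of finite places -/

/-- Reindexing a sum over a `σ`-stable finite set of places along the involution `v ↦ σ • v` (`σ² = 1` for the
automorphism of a conjugation datum). [cite: Howard2004HeegnerKolyvagin, §1.3 (arXiv:1202.6340 p. 7 L33–48)] -/
theorem sum_comp_sigma_smul_eq (S : DVRSetting p K R N Rk Nbar Nq) {A : Type*} [AddCommMonoid A]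
    (S₀ : Finset (HeightOneSpectrum (𝓞 K))) (hS₀ : ∀ v ∈ S₀, S.cd.σ • v ∈ S₀)
    (f : HeightOneSpectrum (𝓞 K) → A) :
    ∑ v ∈ S₀, f (S.cd.σ • v) = ∑ v ∈ S₀, f v := by
  have hσσ : ∀ v : HeightOneSpectrum (𝓞 K), S.cd.σ • (S.cd.σ • v) = v := fun v ↦ by
    rw [smul_smul, S.cd.sigma_mul_sigma_eq_one, one_smul]
  exact Finset.sum_bij' (fun v _ ↦ S.cd.σ • v) (fun v _ ↦ S.cd.σ • v) (fun v hv ↦ hS₀ v hv)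
    (fun v hv ↦ hS₀ v hv) (fun v _ ↦ hσσ v) (fun v _ ↦ hσσ v) (fun v _ ↦ rfl)

section FlipSum

variable (S : DVRSetting p K R N Rk Nbar Nq) (hy : S.SatisfiesH) {k : ℕ}
  (lam : Rk 0 →+ ZMod (p ^ k))
  (hlam : ∀ (z : ℤ_[p]) (r : Rk 0), lam (algebraMap ℤ_[p] (Rk 0) z * r) = PadicInt.toZModPow k z * lam r)
  (exp : ZMod (p ^ k) →+ MuCarrier K (p ^ k))
  (hexp : ∀ (g : absoluteGaloisGroup K) (x : ZMod (p ^ k)),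
    exp (cyclotomicCharacterModPow K p k g * x) = mu K (p ^ k) g (exp x))

include hy hlam hexp in
/-- **FLIP of a (global, local) sum over a `σ`-stable set of finite places** at the bottom level of a full tower
(`e₀ = 1`): for a GLOBAL `c ∈ H¹(K, T^{(0)})`, a LOCAL family `Y_w ∈ H¹(K_w, T^{(0)})` and a `σ`-stable finite `S₀`,
`∑_{v ∈ S₀} ⟨loc_v c, T⁰_v Y_{σv}⟩_v = ∑_{w ∈ S₀} ⟨Y_w, T⁰_w (loc_{σw} c)⟩_w`,
`T⁰_w = H¹(Θ₀) ∘ transport_w`, `⟨·,·⟩_w = localTatePairingZMod (S.T.ρ 0) (p^k) (inr w) (inv (inr w))` — termwise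
`localTatePairingZMod_localization_transportH1_flip`, then `v ↦ σv`.
[cite: Howard2004HeegnerKolyvagin, Thm. 1.4.2 (ii) and Lemma 1.5.3 (arXiv:1202.6340 p0008 L142 – p0009 L55; p. 10 L10–16)] [cite: MorganSmith2021CTP, Thm. 3.7 and §6.3.1] -/
theorem sum_localTatePairingZMod_localization_transportH1_flip [Finite (N 0)] (he : S.e 0 = 1)
    (inv : LocalInvariants K (p ^ k)) (hinv : inv.IsConjCompatible S.cd.σ)
    (c : galoisCohomology (S.T.ρ 0) 1)
    (Y : ∀ w : HeightOneSpectrum (𝓞 K), galoisCohomology ((S.T.ρ 0).toLocal (Sum.inr w)) 1)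
    (S₀ : Finset (HeightOneSpectrum (𝓞 K))) (hS₀ : ∀ v ∈ S₀, S.cd.σ • v ∈ S₀) :
    ∑ v ∈ S₀, localTatePairingZMod (S.T.ρ 0) (p ^ k) (Sum.inr v) (inv (Sum.inr v))
        (galoisCohomology.localization (S.T.ρ 0) (Sum.inr v) 1 c)
        (galoisCohomology.map (DiscreteGaloisModule.localMap ((S.D 0).toTateDual lam hlam exp hexp) (Sum.inr v)) 1
          (S.cd.transportH1 (S.T.ρ 0) v (Y (S.cd.σ • v)))) =
      ∑ w ∈ S₀, localTatePairingZMod (S.T.ρ 0) (p ^ k) (Sum.inr w) (inv (Sum.inr w)) (Y w)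
        (galoisCohomology.map (DiscreteGaloisModule.localMap ((S.D 0).toTateDual lam hlam exp hexp) (Sum.inr w)) 1
          (S.cd.transportH1 (S.T.ρ 0) w
            (galoisCohomology.localization (S.T.ρ 0) (Sum.inr (S.cd.σ • w)) 1 c))) := by
  rw [← S.sum_comp_sigma_smul_eq S₀ hS₀ (fun w ↦ localTatePairingZMod (S.T.ρ 0) (p ^ k) (Sum.inr w)
      (inv (Sum.inr w)) (Y w)
      (galoisCohomology.map (DiscreteGaloisModule.localMap ((S.D 0).toTateDual lam hlam exp hexp) (Sum.inr w)) 1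
        (S.cd.transportH1 (S.T.ρ 0) w (galoisCohomology.localization (S.T.ρ 0) (Sum.inr (S.cd.σ • w)) 1 c))))]
  refine Finset.sum_congr rfl fun v _ ↦ ?_
  exact S.localTatePairingZMod_localization_transportH1_flip hy lam hlam exp hexp he inv hinv c v (Y (S.cd.σ • v))

end FlipSum

end DVRSetting

end Literature.NumberTheory.GaloisCohomology.Howard2004

end
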